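import Mathlib.LinearAlgebra.Eigenspace.Triangularizable
import Literature.Computability.AlgebraicComplexity.GenericTorusGrading
import Literature.Computability.AlgebraicComplexity.LRCanonicalSubspaces
import HarnessLib

/-!
# Landsberg–Ressayre, Thm. 2.8 — torus weights of the canonical subspaces (LR17 §6)

Topic `Literature/Computability/AlgebraicComplexity`.  Continues `LRCanonicalSubspaces.lean`
(canonical subspaces `𝒫_S = canon Λ A S` of the pencil `Ã = Λ + Σ x_{kj} A_{kj}`) in the
bottom-up proof of `lr_left_equivariant_lower` (LR17 Thm. 2.8).  In LR17 §6 the torus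
`T = T^{GL(E)}` is lifted to a central torus `T̃` of a reductive group `L'` and `ℂⁿ` is decomposed
into `T̃`-weight spaces; here ONE generic torus element `t = diag(p_1, …, p_m)` (distinct primes)
and ONE exact lift `(B, C)` of it (`B Λ = Λ C`, `B A_{kj} = p_k A_{kj} C`) are used, and the weight
spaces are the generalised eigenspaces `E β` of `B` (target) and `F γ` of `C` (source):

* `TorusData`: the datum (`Λ`, `A`, primes `p`, the lift, and the eigenvalue `γ₀ ≠ 0` of `C` on
  the line `ker Λ` — regularity enters only through `ker Λ ⊆ F γ₀`);
* the weights `wt u = γ₀ · ∏ p_i^{u_i}` (`u ∈ ℕ^m`), injective in `u` (unique factorisation), and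
  `A_{kj} (F (wt u)) ⊆ E (wt (u + e_k))`, `Λ (F γ) ⊆ E γ`;
* the graded toolkit (`B`-stable subspaces are sums of their weight pieces; extraction of a weight
  piece from a sum of subspaces each lying in one weight space);
* the comparison spaces `Z S' u` (weight `wt u` carries `𝒫_{S'} ∩ E (wt u)` if `supp u ⊆ S'`,
  else `E (wt u)`) and one step of LR's chain inside them (`map_comap_Z_le`), used in
  `LRCanonicalWeights.lean` to locate the weights of the canonical subspaces `𝒫_S`.

Relation to the earlier plan (B0)–(B6) recorded in `LandsbergRessayreNormalForm.lean`: this file and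
`LRCanonicalWeights.lean`, `LRWeightCount.lean` REPLACE steps (B2) (Fitting reduction to a local
endomorphism algebra), (B4) (block bookkeeping) and (B5) (multiplicity symmetry, the input `h4` of
`GradedPencilCount.lean`), which are not needed once the covariant canonical subspaces `𝒫_S` of
`LRCanonicalSubspaces.lean` (sub-namespace `LRPencil`) replace LR's `L'`-modules; of
`GenericTorusGrading.lean` only the intertwining lemma `map_maxGenEigenspace_le_of_comp_eq_smul`
and unique factorisation `TorusGrading.eq_of_prod_prime_pow_eq` are used, of `GradedPencilCount.lean`
only the count `LR28.card_filter_proper_nonempty`.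

## References

* J. M. Landsberg, N. Ressayre, *Permanent v. determinant: an exponential lower bound assuming
  symmetry and a potential path towards Valiant's conjecture*, Differential Geom. Appl. 55 (2017)
  146–166, arXiv:1508.05788, §6 (proof of Thm. 2.8).
-/

noncomputable section

namespace Literature.Computability.AlgebraicComplexity

namespace LRPencil

open Submodule Module.End Finset

variable {V : Type*} [AddCommGroup V] [Module ℂ V] {m : ℕ}

/-! ### Graded toolkit for one endomorphism -/

section Toolkit

variable (B : Module.End ℂ V)

/-- A `B`-stable subspace is the direct sum of its weight pieces (`ℂ` algebraically closed,
finite dimension). [folklore] -/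
theorem eq_iSup_inf_maxGen [FiniteDimensional ℂ V] {P : Submodule ℂ V} (hP : P.map B ≤ P) :
    P = ⨆ β, P ⊓ B.maxGenEigenspace β :=
  Submodule.eq_iSup_inf_genEigenspace ⊤ (fun _ hv => hP (Submodule.mem_map_of_mem hv))
    (Module.End.iSup_maxGenEigenspace_eq_top B)

/-- **Extraction of a weight piece**: if each `Y i` lies in the weight space `E (w i)`, then the
weight-`β` piece of `Σ_i Y i` is contained in `Σ_{w i = β} Y i` (modular law and independence of
the generalised eigenspaces). [folklore] -/
theorem iSup_inf_maxGen_le {ι : Type*} (Y : ι → Submodule ℂ V) (w : ι → ℂ)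
    (hY : ∀ i, Y i ≤ B.maxGenEigenspace (w i)) (β : ℂ) :
    (⨆ i, Y i) ⊓ B.maxGenEigenspace β ≤ ⨆ (i) (_ : w i = β), Y i := by
  set Y₁ : Submodule ℂ V := ⨆ (i) (_ : w i = β), Y i with hY₁
  set Y₂ : Submodule ℂ V := ⨆ (i) (_ : w i ≠ β), Y i with hY₂
  have hsplit : (⨆ i, Y i) ≤ Y₁ ⊔ Y₂ := iSup_le fun i => by
    by_cases h : w i = β
    · exact (le_iSup₂ (f := fun i (_ : w i = β) => Y i) i h).trans le_sup_left
    · exact (le_iSup₂ (f := fun i (_ : w i ≠ β) => Y i) i h).trans le_sup_right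
  have h1 : Y₁ ≤ B.maxGenEigenspace β := iSup₂_le fun i hi => hi ▸ hY i
  have h2 : Y₂ ≤ ⨆ (β') (_ : β' ≠ β), B.maxGenEigenspace β' :=
    iSup₂_le fun i hi => (hY i).trans
      (le_iSup₂ (f := fun β' (_ : β' ≠ β) => B.maxGenEigenspace β') (w i) hi)
  have hdisj : Disjoint (B.maxGenEigenspace β) (⨆ (β') (_ : β' ≠ β), B.maxGenEigenspace β') :=
    B.independent_maxGenEigenspace β
  have h0 : Y₂ ⊓ B.maxGenEigenspace β = ⊥ := (hdisj.mono_right h2).symm.eq_bot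
  calc (⨆ i, Y i) ⊓ B.maxGenEigenspace β
      ≤ (Y₁ ⊔ Y₂) ⊓ B.maxGenEigenspace β := inf_le_inf_right _ hsplit
    _ = Y₁ ⊔ Y₂ ⊓ B.maxGenEigenspace β := sup_inf_assoc_of_le Y₂ h1
    _ = Y₁ := by rw [h0, sup_bot_eq]

/-- In particular a sum of weight spaces meets a weight space `E β` with `β` not among the
weights trivially. [folklore] -/
theorem iSup_maxGen_inf_eq_bot {ι : Type*} (w : ι → ℂ) {β : ℂ} (hβ : ∀ i, w i ≠ β) :
    (⨆ i, B.maxGenEigenspace (w i)) ⊓ B.maxGenEigenspace β = ⊥ := by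
  rw [eq_bot_iff]
  refine (iSup_inf_maxGen_le B (fun i => B.maxGenEigenspace (w i)) w (fun _ => le_rfl) β).trans ?_
  exact iSup₂_le fun i hi => (hβ i hi).elim

end Toolkit

/-! ### Exponent vectors, supports -/

section Supp

/-- The support of `u ∈ ℕ^m` (LR17 §6: the length `ℓ(χ)` of a weight is its cardinality).
[cite: LandsbergRessayre2017, §6] -/
def supp (u : Fin m → ℕ) : Finset (Fin m) := univ.filter fun i => u i ≠ 0

/-- The admissible exponents for the rows `S`: `u ≠ 0` with `supp u ⊆ S`. [folklore] -/
def U (S : Finset (Fin m)) : Set (Fin m → ℕ) := {u | u ≠ 0 ∧ supp u ⊆ S}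

/-- `supp u = ∅ ↔ u = 0`. [folklore] -/
theorem supp_eq_empty_iff (u : Fin m → ℕ) : supp u = ∅ ↔ u = 0 := by
  simp only [supp, filter_eq_empty_iff, mem_univ, true_implies, not_not]
  exact ⟨fun h => funext h, fun h i => by rw [h]; rfl⟩

/-- `supp (u + e_k) = insert k (supp u)`. [folklore] -/
theorem supp_add_single (u : Fin m → ℕ) (k : Fin m) :
    supp (u + Pi.single k 1) = insert k (supp u) := by
  ext i
  simp only [supp, mem_filter, mem_univ, true_and, mem_insert, Pi.add_apply]
  by_cases hik : i = k
  · subst hik; simp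
  · simp [hik]

/-- `u + e_k ∈ U S` when `supp u ⊆ S` and `k ∈ S`. [folklore] -/
theorem add_single_mem_U {S : Finset (Fin m)} {u : Fin m → ℕ} (hu : supp u ⊆ S) {k : Fin m}
    (hk : k ∈ S) : u + Pi.single k 1 ∈ U S := by
  refine ⟨fun h => ?_, ?_⟩
  · have := congrFun h k
    simp at this
  · rw [supp_add_single]; exact insert_subset hk hu

/-- `e_k ∈ U S` for `k ∈ S`. [folklore] -/
theorem single_mem_U {S : Finset (Fin m)} {k : Fin m} (hk : k ∈ S) :
    (0 : Fin m → ℕ) + Pi.single k 1 ∈ U S :=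
  add_single_mem_U (by rw [(supp_eq_empty_iff 0).2 rfl]; exact empty_subset _) hk

/-- `U` is monotone. [folklore] -/
theorem U_mono {S S' : Finset (Fin m)} (h : S' ⊆ S) : U S' ⊆ U S :=
  fun _ hu => ⟨hu.1, hu.2.trans h⟩

end Supp

/-! ### The torus datum -/

/-- The datum of LR17 §6 in elementary form: the pencil (`Λ`, `A_{kj}`), distinct primes `p`,
ONE exact lift `L = (B, C)` of the torus element `diag(p)` (`B Λ = Λ C`, `B A_{kj} = p_k A_{kj} C`),
and the eigenvalue `γ₀ ≠ 0` of `C` on `ker Λ` (for a regular representation `ker Λ` is a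
`C`-stable line, so such `γ₀` exists). [cite: LandsbergRessayre2017, §6] -/
structure TorusData (m : ℕ) (V : Type*) [AddCommGroup V] [Module ℂ V] where
  /-- the constant part -/
  Λ : Module.End ℂ V
  /-- the coefficient of the variable `x_{kj}` -/
  A : Fin m → Fin m → Module.End ℂ V
  /-- the primes on the diagonal of the torus element -/
  p : Fin m → ℕ
  /-- they are primes -/
  prime : ∀ i, (p i).Prime
  /-- and distinct -/
  p_inj : Function.Injective p
  /-- the lift of `diag(p)` -/
  L : Lift Λ A 1 fun k => (p k : ℂ)
  /-- the eigenvalue of `C` on `ker Λ` -/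
  γ₀ : ℂ
  /-- `ker Λ ⊆ F γ₀` -/
  ker_le : LinearMap.ker Λ ≤ Module.End.maxGenEigenspace (L.C : V →ₗ[ℂ] V) γ₀
  /-- `γ₀ ≠ 0` -/
  γ₀_ne : γ₀ ≠ 0

namespace TorusData

variable (D : TorusData m V)

/-- `B` as an endomorphism. [folklore] -/
abbrev B : Module.End ℂ V := (D.L.B : V →ₗ[ℂ] V)

/-- `C` as an endomorphism. [folklore] -/
abbrev C : Module.End ℂ V := (D.L.C : V →ₗ[ℂ] V)

/-- Target weight space `E β` (generalised eigenspace of `B`). [cite: LandsbergRessayre2017, §6] -/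
abbrev E (β : ℂ) : Submodule ℂ V := D.B.maxGenEigenspace β

/-- Source weight space `F γ` (generalised eigenspace of `C`). [cite: LandsbergRessayre2017, §6] -/
abbrev F (γ : ℂ) : Submodule ℂ V := D.C.maxGenEigenspace γ

/-- The weight `wt u = γ₀ · ∏ p_i^{u_i}` attached to `u ∈ ℕ^m` (LR17 §6: the character
`Σ u_i ε_i`, shifted by the weight of `ker Λ`). [cite: LandsbergRessayre2017, §6] -/
def wt (u : Fin m → ℕ) : ℂ := D.γ₀ * ∏ i, (D.p i : ℂ) ^ u i

/-- `wt 0 = γ₀`. [folklore] -/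
@[simp] theorem wt_zero : D.wt 0 = D.γ₀ := by simp [wt]

/-- `wt (u + e_k) = p_k · wt u`. [folklore] -/
theorem wt_add_single (u : Fin m → ℕ) (k : Fin m) :
    D.wt (u + Pi.single k 1) = (D.p k : ℂ) * D.wt u := by
  have h1 : (∏ i, (D.p i : ℂ) ^ (u + Pi.single k 1 : Fin m → ℕ) i) =
      (∏ i, (D.p i : ℂ) ^ u i) * D.p k := by
    have : (∏ i, (D.p i : ℂ) ^ (u + Pi.single k 1 : Fin m → ℕ) i) =
        ∏ i, ((D.p i : ℂ) ^ u i * (D.p i : ℂ) ^ (Pi.single k 1 : Fin m → ℕ) i) :=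
      prod_congr rfl fun i _ => by rw [Pi.add_apply, pow_add]
    rw [this, prod_mul_distrib]
    congr 1
    rw [prod_eq_single k (fun j _ hj => by rw [Pi.single_eq_of_ne hj, pow_zero]) (by simp)]
    simp
  simp only [wt]
  rw [h1]; ring

/-- `wt` is injective (unique factorisation, `γ₀ ≠ 0`). [folklore] -/
theorem wt_injective : Function.Injective D.wt := by
  intro u v h
  have h' : (∏ i, (D.p i : ℂ) ^ u i) = ∏ i, (D.p i : ℂ) ^ v i := mul_left_cancel₀ D.γ₀_ne h
  apply TorusGrading.eq_of_prod_prime_pow_eq D.prime D.p_inj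
  exact_mod_cast h'

/-! ### Weight shifts -/

/-- `Λ (F γ) ⊆ E γ`. [cite: LandsbergRessayre2017, §6] -/
theorem map_Λ_F_le (γ : ℂ) : (D.F γ).map D.Λ ≤ D.E γ := by
  have h : D.B ∘ₗ D.Λ = (1 : ℂ) • (D.Λ ∘ₗ D.C) := by
    rw [one_smul]; exact D.L.comp_Λ
  simpa using map_maxGenEigenspace_le_of_comp_eq_smul _ _ D.Λ 1 h γ

/-- `A_{kj} (F γ) ⊆ E (p_k γ)`. [cite: LandsbergRessayre2017, §6] -/
theorem map_A_F_le (k j : Fin m) (γ : ℂ) : (D.F γ).map (D.A k j) ≤ D.E (D.p k * γ) :=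
  map_maxGenEigenspace_le_of_comp_eq_smul _ _ (D.A k j) _ (D.L.comp_A k j) γ

/-- `A_{kj} (F (wt u)) ⊆ E (wt (u + e_k))`. [cite: LandsbergRessayre2017, §6] -/
theorem map_A_F_wt_le (k j : Fin m) (u : Fin m → ℕ) :
    (D.F (D.wt u)).map (D.A k j) ≤ D.E (D.wt (u + Pi.single k 1)) := by
  rw [wt_add_single]; exact D.map_A_F_le k j _

/-- `A_{kj} (ker Λ) ⊆ E (wt e_k)`. [cite: LandsbergRessayre2017, §6] -/
theorem map_A_ker_le (k j : Fin m) :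
    (LinearMap.ker D.Λ).map (D.A k j) ≤ D.E (D.wt (0 + Pi.single k 1)) :=
  (Submodule.map_mono D.ker_le).trans (by simpa using D.map_A_F_wt_le k j 0)

/-- `ker Λ` meets no `F (wt u)` with `u ≠ 0`. [folklore] -/
theorem ker_inf_F_wt_eq_bot {u : Fin m → ℕ} (hu : u ≠ 0) : LinearMap.ker D.Λ ⊓ D.F (D.wt u) = ⊥ := by
  have hne : D.γ₀ ≠ D.wt u := by
    rw [← D.wt_zero]; exact fun h => hu (D.wt_injective h).symm
  rw [eq_bot_iff]
  exact (le_inf (inf_le_left.trans D.ker_le) inf_le_right).trans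
    (Module.End.disjoint_genEigenspace D.C hne ⊤ ⊤).le_bot

/-- `E β` is `B`-stable. [folklore] -/
theorem map_E_le (β : ℂ) : (D.E β).map D.B ≤ D.E β :=
  Submodule.map_le_iff_le_comap.2 fun _ hv =>
    Module.End.mapsTo_maxGenEigenspace_of_comm (Commute.refl D.B) β hv

/-! ### Weights of the canonical subspaces -/

/-- The comparison space for `S' ⊆ S`: weight `wt u` carries `𝒫_{S'} ∩ E (wt u)` if
`supp u ⊆ S'` and all of `E (wt u)` otherwise (a bookkeeping device of this formalisation). [folklore] -/
def Z (S' : Finset (Fin m)) (u : Fin m → ℕ) : Submodule ℂ V :=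
  if supp u ⊆ S' then canon D.Λ D.A S' ⊓ D.E (D.wt u) else D.E (D.wt u)

/-- `Z S' u` for `supp u ⊆ S'`. [folklore] -/
theorem Z_eq_of_subset {S' : Finset (Fin m)} {u : Fin m → ℕ} (h : supp u ⊆ S') :
    D.Z S' u = canon D.Λ D.A S' ⊓ D.E (D.wt u) := if_pos h

/-- `Z S' u` for `supp u ⊄ S'`. [folklore] -/
theorem Z_eq_of_not_subset {S' : Finset (Fin m)} {u : Fin m → ℕ} (h : ¬ supp u ⊆ S') :
    D.Z S' u = D.E (D.wt u) := if_neg h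

/-- `Z S' u ⊆ E (wt u)`. [folklore] -/
theorem Z_le_E (S' : Finset (Fin m)) (u : Fin m → ℕ) : D.Z S' u ≤ D.E (D.wt u) := by
  unfold Z; split_ifs
  · exact inf_le_right
  · exact le_rfl

/-- `Z S' u` is `B`-stable. [folklore] -/
theorem map_Z_le (S' : Finset (Fin m)) (u : Fin m → ℕ) : (D.Z S' u).map D.B ≤ D.Z S' u := by
  unfold Z
  split_ifs
  · exact (Submodule.map_inf_le _).trans (inf_le_inf (D.L.map_canon_eq_self S').le (D.map_E_le _))
  · exact D.map_E_le _

/-- One step of the chain inside the comparison space: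
`A_{kj} (Λ⁻¹ (Z S' u) ∩ F (wt u)) ⊆ Z S' (u + e_k)`. [folklore] -/
theorem map_comap_Z_le (S' : Finset (Fin m)) (k j : Fin m) (u : Fin m → ℕ) :
    ((D.Z S' u).comap D.Λ ⊓ D.F (D.wt u)).map (D.A k j) ≤ D.Z S' (u + Pi.single k 1) := by
  have hE : ((D.Z S' u).comap D.Λ ⊓ D.F (D.wt u)).map (D.A k j) ≤ D.E (D.wt (u + Pi.single k 1)) :=
    (Submodule.map_mono inf_le_right).trans (D.map_A_F_wt_le k j u)
  by_cases h' : supp (u + Pi.single k 1) ⊆ S'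
  · have hu : supp u ⊆ S' := by
      rw [supp_add_single] at h'; exact (subset_insert _ _).trans h'
    have hkS' : k ∈ S' := by rw [supp_add_single] at h'; exact h' (mem_insert_self _ _)
    rw [D.Z_eq_of_subset h']
    refine le_inf ?_ hE
    calc ((D.Z S' u).comap D.Λ ⊓ D.F (D.wt u)).map (D.A k j)
        ≤ ((canon D.Λ D.A S').comap D.Λ).map (D.A k j) := by
          refine Submodule.map_mono (inf_le_left.trans (Submodule.comap_mono ?_))
          rw [D.Z_eq_of_subset hu]; exact inf_le_left
      _ ≤ canon D.Λ D.A S' := isClosedUnder_canon S' k hkS' j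
  · rw [D.Z_eq_of_not_subset h']
    exact hE

/-- `A_{kj} (ker Λ) ⊆ Z S' e_k`. [folklore] -/
theorem map_ker_le_Z (S' : Finset (Fin m)) (k j : Fin m) :
    (LinearMap.ker D.Λ).map (D.A k j) ≤ D.Z S' (0 + Pi.single k 1) := by
  unfold Z
  split_ifs with h
  · have hk : k ∈ S' := by
      rw [supp_add_single] at h; exact h (mem_insert_self _ _)
    exact le_inf (map_ker_le_canon hk j) (D.map_A_ker_le k j)
  · exact D.map_A_ker_le k j

end TorusData

end LRPencil

end Literature.Computability.AlgebraicComplexity
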